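import Summits.NavierStokesRegularity.NavierStokesRegularity.Theorems.TypeIliouvilleNoTypeII.Negative.NSISuperCascadeRateWindow
import Summits.NavierStokesRegularity.NavierStokesRegularity.Theorems.TypeIliouvilleNoTypeII.Negative.NSISuperCascadeWeak
import Mathlib.Analysis.Calculus.BumpFunction.FiniteDimension
import HarnessLib

/-!
# Strict energy loss of NSI blocks: the gain–contraction bound `g²τ³ < 1`, `β < 3/5` strictly

Negative-lane support file for `stmt-NavierStokesRegularity-0056`
(`Summit.NavierStokesRegularity.NavierStokesRegularity.Theses.TypeILiouville.TypeIliouvilleNoTypeII`),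
model-class REACH of the counterexample family `glueG` of `NSISuperCascadeNotTypeI.lean` /
`NSISuperCascadePieces.lean` (kill-kit M2′). New kernel content (the tree so far had only the
trivial `sup · volume` energy bounds `IsNSIBlock.exists_energy_bound`, `IsSuperBlock.energy_glueG`):

* `nsiBlock_energy_le` — **the energy inequality of a classical NSI block**: for every
  `ν ∈ [0, ν₀]`, `∫|u(T)|² − ∫|u(0)|² + 2ν ∫₀ᵀ∫|∇u|² ≤ 0` (the tree's local energy inequality with
  boundary terms `nsi_localEnergyIneq_Icc` tested against a space–time plateau `θ ≡ 1` near
  `[0,T] × G`, `exists_spaceTime_plateau`);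
* `nsiBlock_dissipation_pos` — `∫₀ᵀ∫|∇u|² > 0` (a compactly supported slice with `∇u ≡ 0` is `0`,
  contradicting `supp u(t) = G ≠ ∅`), hence `nsiBlock_energy_final_lt_initial`:
  **`∫|u(T)|² < ∫|u(0)|²`**;
* `nsiBlock_gain_sq_mul_cube_lt_one` — **every gain `g ≥ 0` with `g|u(0,y)| ≤ |u(T, τy + z)|` obeys
  `g²τ³ < 1`** (change of variables `x = τy + z`: `g²τ³∫|u(0)|² ≤ ∫|u(T)|² < ∫|u(0)|²`);
* `IsSuperBlock.cap_lt_one` — the energy cap of `IsSuperBlock` is automatically STRICT, `a²τ³ < 1`,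
  and `IsSuperBlock.rateExp_mem_Ioo` — the amplitude exponent `β = log_{σ⁻²} a` of the
  super-similar cascade lies in `(1/2, 3/5)`, `< 3/5` STRICTLY (`rateExp_le_three_fifths_iff` /
  `three_fifths_le_rateExp_iff` of `NSISuperCascadeRateWindow.lean`): the rate window of the family
  is the OPEN interval `(1/2, 3/5)`; the endpoint `β = 3/5` (`a = τ^{-3/2}`, lossless focusing) is
  not attained by any single-template NSI cascade;
* `norm_glueG_le_rate` — the matching UPPER rate bound `|𝔲(t,x)| ≤ M (T₀ − t)^{−β}` on `[0, T₀)`,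
  so `β` is the exact blow-up rate of the family (lower bound: `exists_rate_glueG`).

Consequences (recorded in the sequel file on slice energies): since `a²τ³ < 1` the slice energies
of the cascade on the `j`-th strip are `(a²τ³)ʲ`-small, so the super-similar switching class
(including Scheffer–Ożański, `a = τ⁻¹`) carries NO energy atom at its blow-up time, and a mechanism
for `TypeIliouvilleNoTypeII` whose obstruction lives at rates `β ≥ 3/5` or at an energy atom is not
refuted by this model class. WHAT THIS IS NOT: not a statement about Navier–Stokes solutions.

## References

* W. S. Ożański, arXiv:1709.00602 (2017), §1 (1.5), §2. [`Ozanski2017NSISingular`]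
* V. Scheffer, Comm. Math. Phys. 101 (1985), Lemma 2.3. [`Scheffer1985`]
-/

noncomputable section

open MeasureTheory Set Function Filter Topology TopologicalSpace Metric Module
open scoped ENNReal InnerProductSpace RealInnerProductSpace ContDiff Laplacian

set_option linter.dupNamespace false

namespace Summit.NavierStokesRegularity.NavierStokesRegularity.Theorems.TypeIliouvilleNoTypeIINegative

open Literature.Analysis.FluidPDE Literature.Barriers.NavierStokesRegularity
open Literature.Barriers.NavierStokesRegularity.Scheffer

/-! ### A space–time plateau test function -/

section Plateau

variable {E : Type*} [NormedAddCommGroup E] [InnerProductSpace ℝ E] [FiniteDimensional ℝ E]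

/-- **A space–time plateau**: for compact `K ⊆ ℝ × E` there is a nonnegative space–time test
function `θ` equal to `1` on a neighbourhood of every point of `K` (a `ContDiffBump` centred at
`0` whose inner ball contains `K`). [folklore] -/
theorem exists_spaceTime_plateau {K : Set (ℝ × E)} (hK : IsCompact K) :
    ∃ θ : ℝ → E → ℝ, IsSpaceTimeTestOn (⊤ : Opens (ℝ × E)) θ ∧ (∀ t x, 0 ≤ θ t x) ∧
      ∀ z ∈ K, (fun w : ℝ × E => θ w.1 w.2) =ᶠ[𝓝 z] fun _ => (1 : ℝ) := by
  obtain ⟨R₀, hR₀⟩ := hK.isBounded.subset_closedBall (0 : ℝ × E)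
  set R : ℝ := |R₀| + 1 with hR
  have hR0 : 0 < R := by positivity
  have hKR : K ⊆ ball (0 : ℝ × E) R :=
    hR₀.trans (closedBall_subset_ball (by rw [hR]; linarith [le_abs_self R₀]))
  let f : ContDiffBump (0 : ℝ × E) := ⟨R, R + 1, hR0, by linarith⟩
  refine ⟨fun t x => f (t, x), ⟨f.contDiff, f.hasCompactSupport, by simp⟩, fun t x => f.nonneg,
    fun z hz => ?_⟩
  filter_upwards [isOpen_ball.mem_nhds (hKR hz)] with w hw
  exact f.one_of_mem_closedBall (ball_subset_closedBall hw)

/-- On the plateau all the derivatives entering the local energy inequality vanish: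
`θ = 1`, `∂ₜθ = 0`, `∇θ(t,·) = 0`, `Δθ(t,·) = 0`. [folklore] -/
theorem plateau_derivs {θ : ℝ → E → ℝ} {t : ℝ} {x : E}
    (hev : (fun w : ℝ × E => θ w.1 w.2) =ᶠ[𝓝 (t, x)] fun _ => (1 : ℝ)) :
    θ t x = 1 ∧ timeDeriv θ t x = 0 ∧ gradient (θ t) x = 0 ∧ Δ (θ t) x = 0 := by
  haveI : CompleteSpace E := FiniteDimensional.complete ℝ E
  have ht : (fun s => θ s x) =ᶠ[𝓝 t] fun _ => (1 : ℝ) :=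
    (Continuous.prodMk_left x).continuousAt.tendsto.eventually hev
  have hx : (θ t) =ᶠ[𝓝 x] fun _ => (1 : ℝ) :=
    (Continuous.prodMk_right t).continuousAt.tendsto.eventually hev
  refine ⟨hev.self_of_nhds, ?_, ?_, ?_⟩
  · rw [timeDeriv_apply, ht.deriv_eq, deriv_const]
  · rw [hx.gradient_eq, gradient_fun_const]
  · rw [(InnerProductSpace.laplacian_congr_nhds hx).self_of_nhds, InnerProductSpace.laplacian_const,
      Pi.zero_apply]

end Plateau

/-! ### The energy inequality of a classical NSI block and its strictness -/

section Block

variable {T ν₀ τ : ℝ} {z : EuclideanSpace ℝ (Fin 3)} {G : Set (EuclideanSpace ℝ (Fin 3))}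
  {u : ℝ → EuclideanSpace ℝ (Fin 3) → EuclideanSpace ℝ (Fin 3)}

/-- **The energy inequality of a classical NSI block**: for every `ν ∈ [0, ν₀]`,
`∫|u(T)|² − ∫|u(0)|² + 2ν ∫₀ᵀ∫|∇u|² ≤ 0` — the local energy inequality with boundary terms
(`nsi_localEnergyIneq_Icc`, Ożański 2017 (1.5)) tested against a plateau `θ ≡ 1` near the compact
space–time support `[0,T] × G`, where every term of the right-hand side carries a derivative of `θ`
at a point of the support and vanishes. [cite: Ozanski2017NSISingular, §1 (1.5)] -/
theorem nsiBlock_energy_le (h : IsNSIBlock T ν₀ τ z G u) {ν : ℝ} (hν : ν ∈ Icc 0 ν₀) :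
    (∫ x, ‖u T x‖ ^ 2) - (∫ x, ‖u 0 x‖ ^ 2) +
        2 * ν * ∫ t in Ioo 0 T, ∫ x, frobeniusNormSq (fderiv ℝ (u t) x) ≤ 0 := by
  obtain ⟨θ, hθ, hθ0, hθ1⟩ :=
    exists_spaceTime_plateau (isCompact_Icc.prod h.isCompact : IsCompact (Icc (0 : ℝ) T ×ˢ G))
  obtain ⟨η, hη, hsm⟩ := h.smooth
  have hIcc : Icc (0 : ℝ) T ⊆ Ioo (-η) (T + η) := fun t ht => ⟨by linarith [ht.1], by linarith [ht.2]⟩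
  have key := nsi_localEnergyIneq_Icc (p := fun t => normalisedPressure (u t)) h.T_pos.le isOpen_Ioo
    hIcc hsm h.isCompact (fun s hs x hx => h.apply_eq_zero_of_notMem hs hx) h.divFree
    (fun s hs => (contDiff_normalisedPressure_of_hasCompactSupport (h.contDiff_slice hs)
      (h.hasCompactSupport_slice hs)).of_le one_le_two)
    h.continuousOn_normalisedPressure (h.nsi ν hν) hθ hθ0
  -- consequences of the plateau on `[0,T] × G`
  have hpl : ∀ t ∈ Icc (0 : ℝ) T, ∀ x ∈ G,
      θ t x = 1 ∧ timeDeriv θ t x = 0 ∧ gradient (θ t) x = 0 ∧ Δ (θ t) x = 0 :=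
    fun t ht x hx => plateau_derivs (hθ1 (t, x) ⟨ht, hx⟩)
  -- boundary terms
  have hbd : ∀ t ∈ Icc (0 : ℝ) T, (∫ x, ‖u t x‖ ^ 2 * θ t x) = ∫ x, ‖u t x‖ ^ 2 := by
    intro t ht
    refine integral_congr_ae (Eventually.of_forall fun x => ?_)
    beta_reduce
    by_cases hx : x ∈ G
    · rw [(hpl t ht x hx).1, mul_one]
    · simp [h.apply_eq_zero_of_notMem ht hx]
  -- dissipation term
  have hds : (∫ t in Ioo 0 T, ∫ x, frobeniusNormSq (fderiv ℝ (u t) x) * θ t x) =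
      ∫ t in Ioo 0 T, ∫ x, frobeniusNormSq (fderiv ℝ (u t) x) := by
    refine setIntegral_congr_fun measurableSet_Ioo fun t ht => ?_
    refine integral_congr_ae (Eventually.of_forall fun x => ?_)
    beta_reduce
    by_cases hx : x ∈ G
    · rw [(hpl t (Ioo_subset_Icc_self ht) x hx).1, mul_one]
    · rw [h.fderiv_slice_eq_zero_of_notMem (Ioo_subset_Icc_self ht) hx, frobeniusNormSq_zero, zero_mul]
  -- the right-hand side vanishes identically
  have hrhs : (∫ t in Ioo 0 T, ∫ x, (‖u t x‖ ^ 2 * (timeDeriv θ t x + ν * Δ (θ t) x) +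
      (‖u t x‖ ^ 2 + 2 * normalisedPressure (u t) x) * ⟪u t x, gradient (θ t) x⟫)) = 0 := by
    have hz : EqOn (fun t => ∫ x, (‖u t x‖ ^ 2 * (timeDeriv θ t x + ν * Δ (θ t) x) +
        (‖u t x‖ ^ 2 + 2 * normalisedPressure (u t) x) * ⟪u t x, gradient (θ t) x⟫))
        (fun _ => (0 : ℝ)) (Ioo 0 T) := by
      intro t ht
      refine (integral_congr_ae (Eventually.of_forall fun x => ?_)).trans (integral_zero _ _)
      beta_reduce
      by_cases hx : x ∈ G
      · obtain ⟨-, h1, h2, h3⟩ := hpl t (Ioo_subset_Icc_self ht) x hx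
        rw [h1, h2, h3, inner_zero_right]
        ring
      · rw [h.apply_eq_zero_of_notMem (Ioo_subset_Icc_self ht) hx, norm_zero, inner_zero_left]
        ring
    rw [setIntegral_congr_fun measurableSet_Ioo hz, integral_zero]
  rw [hbd T ⟨h.T_pos.le, le_rfl⟩, hbd 0 ⟨le_rfl, h.T_pos.le⟩, hds, hrhs] at key
  exact key

/-- A slice `u(t)`, `t ∈ [0,T]`, of an NSI block has a nonvanishing gradient somewhere: a field
with `∇u(t) ≡ 0` is constant, hence `0` (it vanishes off the compact `G`), contradicting
`supp u(t) = G ≠ ∅`. [folklore] -/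
theorem nsiBlock_exists_fderiv_ne_zero (h : IsNSIBlock T ν₀ τ z G u) {t : ℝ} (ht : t ∈ Icc (0 : ℝ) T) :
    ∃ x, fderiv ℝ (u t) x ≠ 0 := by
  by_contra hcon
  push Not at hcon
  have hdiff : Differentiable ℝ (u t) := (h.contDiff_slice ht).differentiable (by simp)
  obtain ⟨x₁, hx₁⟩ := (Set.ne_univ_iff_exists_notMem G).1 h.isCompact.ne_univ
  have hzero : u t = 0 := funext fun x => by
    rw [is_const_of_fderiv_eq_zero hdiff hcon x x₁, h.apply_eq_zero_of_notMem ht hx₁, Pi.zero_apply]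
  exact h.nonempty.ne_empty ((h.tsupport_eq t ht).symm.trans (tsupport_eq_empty_iff.2 hzero))

/-- A nonzero linear map of `ℝ³` has positive Frobenius norm. [folklore] -/
private theorem frobeniusNormSq_pos {L : EuclideanSpace ℝ (Fin 3) →L[ℝ] EuclideanSpace ℝ (Fin 3)}
    (hL : L ≠ 0) : 0 < frobeniusNormSq L := by
  refine (frobeniusNormSq_nonneg L).lt_of_ne fun h0 => hL ?_
  have h := h0.symm
  rw [frobeniusNormSq_eq_sum (EuclideanSpace.basisFun (Fin 3) ℝ) L,
    Finset.sum_eq_zero_iff_of_nonneg fun _ _ => sq_nonneg _] at h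
  have hb : ∀ j, L (EuclideanSpace.basisFun (Fin 3) ℝ j) = 0 := fun j =>
    norm_eq_zero.mp ((pow_eq_zero_iff two_ne_zero).mp (h j (Finset.mem_univ j)))
  exact ContinuousLinearMap.coe_injective
    ((EuclideanSpace.basisFun (Fin 3) ℝ).toBasis.ext fun j => by simpa using hb j)

/-- **The dissipation of an NSI block is positive**: `0 < ∫₀ᵀ∫|∇u|²`. The integrand is jointly
continuous on `[0,T] × ℝ³`, vanishes off `[0,T] × G` (so the iterated integral is a genuine
product integral, `integrable_prod_of_continuousOn`), and is positive near a point
`(T/2, x₀)` with `∇u(T/2, x₀) ≠ 0`. [folklore] -/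
theorem nsiBlock_dissipation_pos (h : IsNSIBlock T ν₀ τ z G u) :
    0 < ∫ t in Ioo 0 T, ∫ x, frobeniusNormSq (fderiv ℝ (u t) x) := by
  set F : ℝ × EuclideanSpace ℝ (Fin 3) → ℝ := fun q => frobeniusNormSq (fderiv ℝ (u q.1) q.2) with hF
  have hcont : ContinuousOn F (Icc 0 T ×ˢ univ) :=
    LerayHopfProofs.continuous_frobeniusNormSq.comp_continuousOn h.continuousOn_fderiv_slice
  have hF0 : ∀ t ∈ Icc (0 : ℝ) T, ∀ x ∉ G, F (t, x) = 0 := fun t ht x hx => by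
    simp only [hF, h.fderiv_slice_eq_zero_of_notMem ht hx, frobeniusNormSq_zero]
  have hint := integrable_prod_of_continuousOn (a := 0) (b := T) h.isCompact hcont hF0
  have hnn : 0 ≤ F := fun q => frobeniusNormSq_nonneg _
  rw [show (∫ t in Ioo 0 T, ∫ x, frobeniusNormSq (fderiv ℝ (u t) x)) =
      ∫ q, F q ∂(((volume : Measure ℝ).restrict (Ioo 0 T)).prod volume) from
      (integral_prod F hint).symm,
    integral_pos_iff_support_of_nonneg hnn hint, Measure.restrict_prod_eq_prod_univ,
    ← Measure.volume_eq_prod, Measure.restrict_apply' (measurableSet_Ioo.prod MeasurableSet.univ)]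
  -- a point of `(0,T) × ℝ³` where `F > 0`
  have hs₀ : T / 2 ∈ Ioo 0 T := ⟨by linarith [h.T_pos], by linarith [h.T_pos]⟩
  obtain ⟨x₀, hx₀⟩ := nsiBlock_exists_fderiv_ne_zero h (Ioo_subset_Icc_self hs₀)
  have hq₀ : Ioo 0 T ×ˢ (univ : Set (EuclideanSpace ℝ (Fin 3))) ∈
      𝓝 ((T / 2, x₀) : ℝ × EuclideanSpace ℝ (Fin 3)) :=
    (isOpen_Ioo.prod isOpen_univ).mem_nhds ⟨hs₀, mem_univ _⟩
  have hFat : ContinuousAt F (T / 2, x₀) :=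
    hcont.continuousAt (mem_of_superset hq₀ (prod_mono Ioo_subset_Icc_self Subset.rfl))
  have hFne : F (T / 2, x₀) ≠ 0 := (frobeniusNormSq_pos hx₀).ne'
  exact Measure.measure_pos_of_mem_nhds _ (inter_mem (hFat.eventually_ne hFne) hq₀)

/-- **The initial energy of an NSI block is positive** (`u(0) ≢ 0` is continuous with compact
support). [folklore] -/
theorem nsiBlock_energy_initial_pos (h : IsNSIBlock T ν₀ τ z G u) : 0 < ∫ x, ‖u 0 x‖ ^ 2 := by
  obtain ⟨x₀, hx₀⟩ := h.nontrivial
  have h0 : (0 : ℝ) ∈ Icc (0 : ℝ) T := ⟨le_rfl, h.T_pos.le⟩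
  have hc : Continuous fun x => ‖u 0 x‖ ^ 2 := ((h.contDiff_slice h0).continuous.norm).pow 2
  have hcs : HasCompactSupport fun x => ‖u 0 x‖ ^ 2 :=
    (h.hasCompactSupport_slice h0).comp_left (g := fun v : EuclideanSpace ℝ (Fin 3) => ‖v‖ ^ 2)
      (by simp)
  exact hc.integral_pos_of_hasCompactSupport_nonneg_nonzero hcs (fun x => by positivity)
    (pow_ne_zero 2 (norm_ne_zero_iff.2 hx₀))

/-- **Strict energy loss of an NSI block**: `∫|u(T)|² < ∫|u(0)|²` (energy inequality at `ν = ν₀ > 0`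
and positivity of the dissipation). [cite: Ozanski2017NSISingular, §1 (1.5)] -/
theorem nsiBlock_energy_final_lt_initial (h : IsNSIBlock T ν₀ τ z G u) :
    (∫ x, ‖u T x‖ ^ 2) < ∫ x, ‖u 0 x‖ ^ 2 := by
  have h1 := nsiBlock_energy_le h ⟨h.ν₀_pos.le, le_rfl⟩
  have h2 : 0 < 2 * ν₀ * ∫ t in Ioo 0 T, ∫ x, frobeniusNormSq (fderiv ℝ (u t) x) :=
    mul_pos (mul_pos two_pos h.ν₀_pos) (nsiBlock_dissipation_pos h)
  linarith

/-- **The gain–contraction bound**: if `g ≥ 0` and `g|u(0, y)| ≤ |u(T, τy + z)|` for all `y` (an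
interior gain of magnitude `g` under the similarity `Γ(y) = τy + z`), then `g²τ³ < 1`: by the change
of variables `x = Γ(y)`, `g²τ³ ∫|u(0)|² ≤ τ³∫|u(T, Γ(y))|² dy = ∫|u(T)|² < ∫|u(0)|²`, and
`∫|u(0)|² > 0`. For the block's own gain `g = τ⁻¹` this is `τ < 1`; for a super-gain `a` it is the
STRICT energy cap `a²τ³ < 1`. [folklore] -/
theorem nsiBlock_gain_sq_mul_cube_lt_one (h : IsNSIBlock T ν₀ τ z G u) {g : ℝ} (hg : 0 ≤ g)
    (hgain : ∀ y, g * ‖u 0 y‖ ≤ ‖u T (τ • y + z)‖) : g ^ 2 * τ ^ 3 < 1 := by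
  have hT : T ∈ Icc (0 : ℝ) T := ⟨h.T_pos.le, le_rfl⟩
  have hτ3 : 0 < τ ^ 3 := pow_pos h.τ_pos 3
  -- change of variables `x = z + τ y`
  have hcv : (∫ y, ‖u T (z + τ • y)‖ ^ 2) = (τ ^ 3)⁻¹ * ∫ x, ‖u T x‖ ^ 2 := by
    have := integral_comp_space_affine h.τ_pos z (fun x => ‖u T x‖ ^ 2)
    rwa [finrank_euclideanSpace_fin, smul_eq_mul] at this
  -- integrability of the rescaled final energy density
  have huT : Continuous (u T) := (h.contDiff_slice hT).continuous
  have hc : Continuous fun y : EuclideanSpace ℝ (Fin 3) => ‖u T (z + τ • y)‖ ^ 2 := by fun_prop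
  have hcs : HasCompactSupport fun y : EuclideanSpace ℝ (Fin 3) => ‖u T (z + τ • y)‖ ^ 2 := by
    have h1 : HasCompactSupport (u T ∘ ⇑(spaceAffineHomeomorph h.τ_pos.ne' z)) :=
      (h.hasCompactSupport_slice hT).comp_homeomorph _
    exact h1.comp_left (g := fun v : EuclideanSpace ℝ (Fin 3) => ‖v‖ ^ 2) (by simp)
  have hmono : (∫ y, g ^ 2 * ‖u 0 y‖ ^ 2) ≤ ∫ y, ‖u T (z + τ • y)‖ ^ 2 := by
    refine integral_mono_of_nonneg (Eventually.of_forall fun y => by positivity)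
      (hc.integrable_of_hasCompactSupport hcs) (Eventually.of_forall fun y => ?_)
    have hy := hgain y
    rw [add_comm] at hy
    calc g ^ 2 * ‖u 0 y‖ ^ 2 = (g * ‖u 0 y‖) ^ 2 := by ring
      _ ≤ ‖u T (z + τ • y)‖ ^ 2 := pow_le_pow_left₀ (by positivity) hy 2
  rw [integral_const_mul, hcv, ← div_eq_inv_mul, le_div_iff₀ hτ3] at hmono
  -- `g²τ³ E(0) ≤ E(T) < E(0)` with `E(0) > 0`
  have hlt := nsiBlock_energy_final_lt_initial h
  have hE0 := nsiBlock_energy_initial_pos h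
  by_contra hcon
  have hge : (∫ x, ‖u 0 x‖ ^ 2) ≤ g ^ 2 * τ ^ 3 * ∫ x, ‖u 0 x‖ ^ 2 :=
    le_mul_of_one_le_left hE0.le (not_lt.1 hcon)
  nlinarith

/-- In particular (`g = τ⁻¹`, the block's own gain) one recovers `τ < 1` from the energy budget
alone, and for any cascade parameters with `aσ² = τ`, `0 < σ < 1` and a super-gain
`a|u(0,y)| ≤ |u(T, τy + z)|`, the amplitude exponent is **strictly** below the energy endpoint:
`log_{σ⁻²} a < 3/5`. [folklore] -/
theorem rateExp_lt_three_fifths_of_gain (h : IsNSIBlock T ν₀ τ z G u) {σ a : ℝ} (hσ₀ : 0 < σ)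
    (hσ₁ : σ < 1) (ha : 0 < a) (hcov : a * σ ^ 2 = τ)
    (hgain : ∀ y, a * ‖u 0 y‖ ≤ ‖u T (τ • y + z)‖) :
    Real.logb ((σ⁻¹) ^ 2) a < 3 / 5 := by
  have hcap := nsiBlock_gain_sq_mul_cube_lt_one h ha.le hgain
  by_contra hle
  exact (not_le.2 hcap) ((three_fifths_le_rateExp_iff hσ₀ hσ₁ ha hcov).1 (not_lt.1 hle))

/-- **Upper rate bound of the super-similar cascade** (`a ≥ 1`, `0 < σ < 1`): with
`β = log_{σ⁻²} a` there is `M ≥ 0` with `|𝔲(t,x)| ≤ M (T₀ − t)^{−β}` on `[0, T₀) × ℝ³` — on the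
`j`-th strip `|𝔲| ≤ aʲ sup|u|` and `T₀ − t ≤ T₀ − t_j = σ^{2j} T₀`, `(σ^{2j})^{−β} = aʲ`. Together
with `exists_rate_glueG` (the matching lower bound along the centres) the cascade blows up at the
EXACT rate `β`. [cite: Ozanski2017NSISingular, §2 (2.4)] -/
theorem norm_glueG_le_rate (h : IsNSIBlock T ν₀ τ z G u) {σ a : ℝ} (hσ₀ : 0 < σ) (hσ₁ : σ < 1)
    (ha : 1 ≤ a) :
    ∃ M : ℝ, 0 ≤ M ∧ ∀ t ∈ Ico 0 (blowupTime T σ), ∀ x,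
      ‖glueG T σ τ a z u t x‖ ≤ M * (blowupTime T σ - t) ^ (-Real.logb ((σ⁻¹) ^ 2) a) := by
  obtain ⟨M₀, hM₀, hbd⟩ := h.exists_bound_norm
  have ha0 : 0 < a := one_pos.trans_le ha
  have hσ2 : σ ^ 2 < 1 := pow_lt_one₀ hσ₀.le hσ₁ two_ne_zero
  have hb0 : 0 < (σ⁻¹) ^ 2 := by positivity
  have hb1 : 1 < (σ⁻¹) ^ 2 := by
    have h1 : 1 < σ⁻¹ := (one_lt_inv₀ hσ₀).2 hσ₁
    nlinarith
  have hT₀ : 0 < blowupTime T σ := div_pos h.T_pos (by linarith)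
  set β : ℝ := Real.logb ((σ⁻¹) ^ 2) a with hβ
  have hβ0 : 0 ≤ β := Real.logb_nonneg hb1 ha
  refine ⟨M₀ * blowupTime T σ ^ β, by positivity, fun t ht x => ?_⟩
  obtain ⟨j, hj⟩ := exists_mem_Ico_switchTime hσ₀ hσ₁ ht.1 ht.2
  rw [glueG_eq_pieceG h.T_pos hσ₀ τ a z u hj, pieceG_apply, norm_smul,
    Real.norm_of_nonneg (pow_nonneg ha0.le _)]
  have hloc : (σ⁻¹) ^ (2 * j) * (t - switchTime T σ j) ∈ Icc 0 T :=
    localTime_mem_Icc hσ₀ (Ico_subset_Icc_self hj)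
  -- `σ^{2j} = (σ⁻²)^{-j}` and `((σ⁻²)^{-j})^{-β} = ((σ⁻²)^{β})^{j} = aʲ`
  have hσb : σ ^ (2 * j) = ((σ⁻¹) ^ 2) ^ (-(j : ℝ)) := by
    rw [Real.rpow_neg hb0.le, Real.rpow_natCast, ← pow_mul, inv_pow, inv_inv]
  have hpow : (σ ^ (2 * j)) ^ (-β) = a ^ j := by
    rw [hσb, ← Real.rpow_mul hb0.le, neg_mul_neg, mul_comm, Real.rpow_mul_natCast hb0.le,
      Real.rpow_logb hb0 hb1.ne' ha0]
  -- `aʲ ≤ T₀^β (T₀ - t)^{-β}`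
  have hd : 0 < blowupTime T σ - t := sub_pos.2 ht.2
  have hdle : blowupTime T σ - t ≤ σ ^ (2 * j) * blowupTime T σ := by
    have := blowupTime_sub_switchTime T hσ2.ne j
    linarith [hj.1]
  have h1 : (σ ^ (2 * j) * blowupTime T σ) ^ (-β) ≤ (blowupTime T σ - t) ^ (-β) :=
    Real.rpow_le_rpow_of_nonpos hd hdle (neg_nonpos.2 hβ0)
  rw [Real.mul_rpow (pow_nonneg hσ₀.le _) hT₀.le, hpow] at h1
  have hrate : a ^ j ≤ blowupTime T σ ^ β * (blowupTime T σ - t) ^ (-β) := by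
    calc a ^ j = a ^ j * blowupTime T σ ^ (-β) * blowupTime T σ ^ β := by
          rw [mul_assoc, ← Real.rpow_add hT₀, neg_add_cancel, Real.rpow_zero, mul_one]
      _ ≤ (blowupTime T σ - t) ^ (-β) * blowupTime T σ ^ β :=
          mul_le_mul_of_nonneg_right h1 (Real.rpow_nonneg hT₀.le _)
      _ = blowupTime T σ ^ β * (blowupTime T σ - t) ^ (-β) := mul_comm _ _
  calc a ^ j * ‖u ((σ⁻¹) ^ (2 * j) * (t - switchTime T σ j))
          ((1 - τ)⁻¹ • z + (τ⁻¹) ^ j • (x - (1 - τ)⁻¹ • z))‖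
      ≤ a ^ j * M₀ := mul_le_mul_of_nonneg_left (hbd _ hloc _) (pow_nonneg ha0.le _)
    _ ≤ blowupTime T σ ^ β * (blowupTime T σ - t) ^ (-β) * M₀ :=
        mul_le_mul_of_nonneg_right hrate hM₀
    _ = M₀ * blowupTime T σ ^ β * (blowupTime T σ - t) ^ (-β) := by ring

end Block

/-! ### Consequences for the super-similar cascade `glueG` -/

namespace IsSuperBlock

variable {T ν₀ τ σ a : ℝ} {z : EuclideanSpace ℝ (Fin 3)} {G : Set (EuclideanSpace ℝ (Fin 3))}
  {u : ℝ → EuclideanSpace ℝ (Fin 3) → EuclideanSpace ℝ (Fin 3)}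

/-- **The energy cap of a super-block is strict**: `a²τ³ < 1` (so the field `cap : a²τ³ ≤ 1` of
`IsSuperBlock` is implied by the other fields). [folklore] -/
theorem cap_lt_one (h : IsSuperBlock T ν₀ τ σ a z G u) : a ^ 2 * τ ^ 3 < 1 :=
  nsiBlock_gain_sq_mul_cube_lt_one h.block h.gain_pos.le h.gain

/-- **The rate exponent of a super-block cascade is strictly below `3/5`**:
`1/2 < log_{σ⁻²} a < 3/5`. [folklore] -/
theorem rateExp_mem_Ioo (h : IsSuperBlock T ν₀ τ σ a z G u) :
    Real.logb ((σ⁻¹) ^ 2) a ∈ Ioo (1 / 2 : ℝ) (3 / 5) := by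
  refine ⟨(one_half_lt_rateExp_iff h.σ_pos h.σ_lt_one h.gain_pos).2 ?_,
    rateExp_lt_three_fifths_of_gain h.block h.σ_pos h.σ_lt_one h.gain_pos h.cov h.gain⟩
  -- `1 < aσ`: `(aσ)² = a (aσ²) = aτ > 1`
  have hlt : 1 < a * τ := by
    calc (1 : ℝ) = τ⁻¹ * τ := (inv_mul_cancel₀ h.τ_pos.ne').symm
      _ < a * τ := mul_lt_mul_of_pos_right h.inv_lt h.τ_pos
  have h1 : 1 ^ 2 < (a * σ) ^ 2 := by
    calc (1 : ℝ) ^ 2 = 1 := one_pow 2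
      _ < a * τ := hlt
      _ = (a * σ) ^ 2 := by rw [← h.cov]; ring
  exact lt_of_pow_lt_pow_left₀ 2 (mul_pos h.gain_pos h.σ_pos).le h1

end IsSuperBlock

end Summit.NavierStokesRegularity.NavierStokesRegularity.Theorems.TypeIliouvilleNoTypeIINegative

end
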